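import Summits.HodgeConjecture.HodgeConjecture.Theorems.PadicSemiregularLiftFermatAnchorAssemblyStubTransferSum
import Literature.AlgebraicGeometry.HodgeTheory.AbelJacobiPullbackHodgeSection
import Literature.AlgebraicGeometry.Motives.JacobianExistenceSplit

/-!
# Crux `FermatAnchorAssembly` (stmt-HodgeConjecture-14874), line `Sketch`: the transfer over the LEAF facts

Route `PadicSemiregularLift` of `HodgeConjecture`; crux
`FermatAnchorAssembly := PadicPridhamSemiregularity → FormalLiftingFromClassLifting → FormalVectorBundlesAlgebraize →
HodgeFermatVarieties`. The landed transfer `stub_transfer_of_facts_sum`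
(`Theorems/PadicSemiregularLiftFermatAnchorAssemblyStubTransferSum.lean`) reduces `HodgeFermatVarieties` to HC for
the powers of the Fermat Jacobians modulo THREE print facts: the multi-host Shioda–Katsura fact
`FermatHodgeClassesLiftToCurvePowersSum`, the Abel–Jacobi fact `CurvePowerHodgeClassesLiftToJacobianPowers`, and
Milne's existence theorem `Motives.nonempty_jacobian_of_isSmoothProjective` (all fields). Two of these are not leaves
of the tree's debt structure:

* `CurvePowerHodgeClassesLiftToJacobianPowers` is a ONE-LINE consequence of the dimension fact
  `Motives.two_mul_dim_eq_finrank_bettiCohomology` (`2 dim J(C) = b₁(C(ℂ))`, Milne Prop. 2.1) by the tree's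
  `CurvePowerHodgeClassesLiftToJacobianPowers_of_two_mul_dim_eq` (`HodgeTheory/AbelJacobiPullbackHodgeSection`:
  the explicit section of `(αᴺ⁺¹)^*`, Künneth, algebraicity of pull-backs — all proved there);
* over `ℂ` a smooth projective curve has a complex point (`nonempty_algPoints_of_isSmoothProjective`), so only the
  POINTED case `Motives.nonempty_jacobian_of_algPoints` of Milne's theorem (child 1 of
  `Motives/JacobianExistenceSplit`; Weil's construction of `(J, f^P)` with `f^{(g)}` birational) is needed — the
  Galois-descent child `jacobian_galoisDescent` is not.

This file lands the transfer over the leaves,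
`stub_transfer_of_leaf_facts : FermatHodgeClassesLiftToCurvePowersSum → two_mul_dim_eq_finrank_bettiCohomology →
nonempty_jacobian_of_algPoints.{0} → (∀ m C 𝒥, HodgeFermatJacobianPowersAt m C 𝒥) → HodgeFermatVarieties`,
so that the line's skeleton (gen 6) registers the two leaf facts as its print stubs; their common residual content is
exactly Weil's construction of the Jacobian of a pointed curve with `dim J = g` (Milne §§3–5, Thm. 5.1 (a)).
-/

-- `Summit.HodgeConjecture.HodgeConjecture.…` is the tree's mandated summit/problem namespace (single-problem summit).
set_option linter.dupNamespace false

noncomputable section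

open CategoryTheory AlgebraicGeometry
open Literature.AlgebraicGeometry Literature.AlgebraicGeometry.Motives
  Literature.AlgebraicGeometry.HodgeTheory
open Literature.AlgebraicTopology.SingularHomology

namespace Summit.HodgeConjecture.HodgeConjecture.Cruxes.FermatAnchorAssembly.ParallelizableAvatar

/-- **One host, leaf form.** Granted the dimension fact `2 dim J = b₁` (whence the Abel–Jacobi lift,
`CurvePowerHodgeClassesLiftToJacobianPowers_of_two_mul_dim_eq`), the POINTED existence of Jacobians and the
hypothesis of the stub (HC for all powers of all Jacobians of all smooth projective Fermat curves), every rational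
`(q,q)`-class on a power `C_mᴷ` of the standard complex Fermat curve, `m ≥ 1`, is algebraic: the complex curve `C_m`
has a point (`nonempty_algPoints_of_isSmoothProjective`), hence a Jacobian by the pointed case, and the argument of
`mem_algebraicClasses_fermatCurvePow_of_facts` runs verbatim. [cite: Milne1986JacobianVarieties, Thm. 1.1, §2 Prop. 2.1 and §6 Prop. 6.4] -/
theorem mem_algebraicClasses_fermatCurvePow_of_leaf_facts
    (hdim : two_mul_dim_eq_finrank_bettiCohomology)
    (hJ : nonempty_jacobian_of_algPoints.{0})
    (H : ∀ (m : ℕ) (C : SchemeOver ℂ) (𝒥 : Jacobian C), HodgeFermatJacobianPowersAt m C 𝒥)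
    {m : ℕ} (hm : 1 ≤ m) (K q : ℕ) (a : complexBetti ((fermatHypersurface 1 m).pow K) (2 * q))
    (ha : IsRationalClass a) (haH : IsOfHodgeType K ((fermatHypersurface 1 m).pow K) (2 * q) q q a) :
    a ∈ algebraicClasses ((fermatHypersurface 1 m).pow K) q := by
  cases K with
  | zero =>
    have h0 : IsSmoothProjective 0 ((fermatHypersurface 1 m).pow 0) := isSmoothProjective_unit_holds ℂ
    rw [algebraicClasses_eq_top_of_eq_zero_or_le h0 (Or.inr (Nat.zero_le q))]
    exact Submodule.mem_top
  | succ N =>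
    have hC : IsSmoothProjective 1 (fermatHypersurface 1 m) :=
      isSmoothProjective_fermatHypersurface le_rfl hm
    have hCF : IsFermatVariety 1 m (fermatHypersurface 1 m) := isFermatVariety_fermatHypersurface hm
    obtain ⟨𝒥⟩ := hJ ℂ (fermatHypersurface 1 m) hC (HodgeTheory.nonempty_algPoints_of_isSmoothProjective hC)
    have HJ : HodgeConjectureFor (𝒥.J.powSucc N).dim (𝒥.J.powSucc N).X := H m _ 𝒥 hCF hC N
    obtain ⟨G, hGalg, hGlift⟩ :=
      CurvePowerHodgeClassesLiftToJacobianPowers_of_two_mul_dim_eq hdim (fermatHypersurface 1 m) hC 𝒥 N q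
    obtain ⟨b, hbrat, hbpp, hdiff⟩ := hGlift a ha haH
    have hb : b ∈ algebraicClasses (𝒥.J.powSucc N).X q := HJ.2 q b hbrat hbpp
    have hGb : G b ∈ algebraicClasses ((fermatHypersurface 1 m).pow (N + 1)) q := hGalg b hb
    have := Submodule.add_mem _ hdiff hGb
    rwa [sub_add_cancel] at this

/-- **The kernel on the standard model, leaf form.** Granted the multi-host Shioda–Katsura fact, the dimension
fact, the pointed existence of Jacobians and the stub's hypothesis, every rational `(p,p)`-class on the standard
Fermat variety `V₊(Σᵢ xᵢᵐ) ⊂ ℙⁿ⁺¹_ℂ`, `m, n ≥ 1`, is algebraic (finite sum over the hosts `C_m^{kᵢ}`).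
[cite: ShiodaKatsura1979, §1 Thm. 1.7] [cite: Shioda1979HodgeFermat, Thm. I] -/
theorem mem_algebraicClasses_fermatHypersurface_of_leaf_facts
    (hSK : Literature.AlgebraicGeometry.HodgeTheory.FermatHodgeClassesLiftToCurvePowersSum)
    (hdim : two_mul_dim_eq_finrank_bettiCohomology)
    (hJ : nonempty_jacobian_of_algPoints.{0})
    (H : ∀ (m : ℕ) (C : SchemeOver ℂ) (𝒥 : Jacobian C), HodgeFermatJacobianPowersAt m C 𝒥)
    {m n : ℕ} (hm : 1 ≤ m) (hn : 1 ≤ n) (p : ℕ) (c : complexBetti (fermatHypersurface n m) (2 * p))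
    (hc : IsRationalClass c) (hpp : IsOfHodgeType n (fermatHypersurface n m) (2 * p) p p c) :
    c ∈ algebraicClasses (fermatHypersurface n m) p := by
  obtain ⟨ι, _, k, q, F, hFalg, hFlift⟩ := hSK m n p hm hn
  obtain ⟨a, ha, rfl⟩ := hFlift c hc hpp
  exact Submodule.sum_mem _ fun i _ ↦ hFalg i _
    (mem_algebraicClasses_fermatCurvePow_of_leaf_facts hdim hJ H hm (k i) (q i) (a i) (ha i).1 (ha i).2)

/-- **Registered sub-goal `stub_transfer_of_leaf_facts`: the transfer stub modulo the LEAF print facts.** From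
`FermatHodgeClassesLiftToCurvePowersSum` (Shioda–Katsura §1 Thm. 1.7 / Shioda Thm. I, multi-host form),
`Motives.two_mul_dim_eq_finrank_bettiCohomology` (`dim J = g`, Milne Prop. 2.1) and the pointed existence theorem
`Motives.nonempty_jacobian_of_algPoints` (Milne Thm. 1.1, pointed case), HC for all powers of the Fermat Jacobians
implies `HodgeFermatVarieties`: `hodgeFermatVarieties_of_fermatHypersurface` applied to
`mem_algebraicClasses_fermatHypersurface_of_leaf_facts`. [cite: ShiodaKatsura1979, §1 Thm. 1.7]
[cite: Milne1986JacobianVarieties, Thm. 1.1, §2 Prop. 2.1 and §6 Prop. 6.4] -/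
theorem stub_transfer_of_leaf_facts : Literature.AlgebraicGeometry.HodgeTheory.FermatHodgeClassesLiftToCurvePowersSum → two_mul_dim_eq_finrank_bettiCohomology → nonempty_jacobian_of_algPoints.{0} → (∀ (m : ℕ) (C : SchemeOver ℂ) (𝒥 : Jacobian C), HodgeFermatJacobianPowersAt m C 𝒥) → Theses.PadicSemiregularLift.HodgeFermatVarieties :=
  fun hSK hdim hJ H ↦ hodgeFermatVarieties_of_fermatHypersurface
    fun _ _ hm hn p c hc hpp ↦
      mem_algebraicClasses_fermatHypersurface_of_leaf_facts hSK hdim hJ H hm hn p c hc hpp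

end Summit.HodgeConjecture.HodgeConjecture.Cruxes.FermatAnchorAssembly.ParallelizableAvatar

end
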